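import Literature.Analysis.FluidPDE.LocalEnstrophyBalance
import Literature.Analysis.FluidPDE.GrujicZhang2006LocalizedDirectionCriteria
import Literature.Analysis.FluidPDE.WeakKernelBilinearBound
import Literature.Analysis.FluidPDE.GrujicRuzmaikina2004HybridDirectionCriterionHolds
import Literature.Analysis.FluidPDE.WeakL3InitialLayerEstimate
import HarnessLib

/-!
# Grujić–Zhang 2006, Theorem 1.2 — PROVED (discharge of the named fact
# `grujicZhang2006_localized_integral_coherence`)

Analysis/FluidPDE proof file (theorems only: no definition, no named fact, no `sorry`): the
discharge `grujicZhang2006_localized_integral_coherence_holds` of the named fact vendored in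
`GrujicZhang2006LocalizedDirectionCriteria.lean` (Z. Grujić, Qi S. Zhang, *Space-time
localization of a class of geometric criteria for preventing blow-up in the 3D NSE*, Comm. Math.
Phys. **262** (2006) 555–564, **Theorem 1.2**, p. 558: a Leray–Hopf solution smooth on the
backward parabolic cylinder `Q_{2r₀}(x₀, t₀)` whose triple-product depletion factor
`λ(y) = sup_{(x,t) ∈ Q_{2r₀} ∩ {|ω| ≥ d}} |(y, ξ(x+y,t), ξ(x,t))| / |y|⁴` ((1.3)) lies in
`L^{6/5}_w(B(0, 3r₀))` has `sup_{t ∈ (t₀−r₀², t₀)} ∫_{B(x₀,r₀)} |ω|² < ∞`).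

## Proof (Grujić–Zhang p. 563 "Proof of Theorem 1.2. The only modification occurs after (3.6)
## and before (3.7)", pointwise in time; the Grönwall/covering form of the tree's discharges of
## Grujić 2009 Thm. 1 and Grujić–Zhang 2006 Thm. 1.1)

For the tree's Leray–Hopf solution `u` (`IsLerayHopfOn T 1 0 u₀ u`), smooth on
`I × S = (t₀ − 4r₀², t₀) × B(x₀, 2r₀)`:
* the kernel: `k₀(z) = 1_{B(0,3r₀)}(−z) λ(−z)` has the weak-`L^{6/5}` bound of the hypothesis
  (`volume` is invariant under `z ↦ −z`) and is replaced by a MEASURABLE majorant `k ≥ k₀` with the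
  same bound (`exists_measurable_ge_of_weak`, `WeakKernelBilinearBound.lean` — `λ` is a supremum
  over an uncountable family); for `t ∈ I`, `x, y ∈ B(c, 6s) ⊆ B(x₀, 2r₀)` (`s = r₀/16`,
  `c ∈ B̄(x₀, r₀)`, so `|x − y| < 12s < 3r₀`) with `|ω(x,t)| > d` the definition of the supremum
  gives `|⟪x − y, ξ(y,t) × ξ(x,t)⟫| / |x − y|⁴ ≤ λ(y − x) = k₀(x − y) ≤ k(x − y)`;
* the local enstrophy balance `IsLerayHopfOn.exists_weight_localEnstrophy_deriv_le_kernel`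
  (`LocalEnstrophyBalance.lean`, with the stretching estimate
  `exists_localized_stretching_le_of_kernel` of `LocalizedHybridDirectionStretching.lean`: exact
  triple-product pairing of the Biot–Savart gradient, Constantin–Fefferman (2.13), and the two-level
  substitute for the weak Young inequality) on every ball `B(c, 6s)`;
* the Leray–Hopf structure: `∫_{B̄}|u(t)|² ≤ 2E(u₀)` and `∫_I ∫_{B̄(c,6s)}‖∇u‖² < ∞` — whence all
  the coefficients of the balance are integrable on `I` (no time weight is needed: hypothesis
  (1.3) is uniform in time);
* Grönwall's inequality in integral form on `[t₀ − 2r₀², τ]`, uniformly in `τ < t₀`, and a finite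
  cover of `B̄(x₀, r₀)` by balls `B(c, s/2)` on which the weights are `≡ 1` ("the conclusion is
  drawn by shifting the vertex of the cylinder", p. 563).
The datum hypotheses `u₀ ∈ C¹`, `curl u₀ ∈ L¹` of the fact (printed: `ω₀ ∈ L¹(ℝ³)`, used in print
only for the far-field bound (3.6)) are not needed: the far field is handled by the local Helmholtz
representation of `LocalBiotSavartHelmholtz.lean` (recorded deviation).

No regularity claim about Navier–Stokes is made beyond the printed theorem.

## References

* Z. Grujić, Qi S. Zhang, Comm. Math. Phys. 262 (2006) 555–564, Thm. 1.2 and (1.3) (pp. 557–558)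
  and its proof §3 p. 563; Thm. 1.1 proof §2 (2.1)–(2.6), §3 (3.1)–(3.11). [GrujicZhang2006]
* P. Constantin, C. Fefferman, Indiana Univ. Math. J. 42 (1993) 775–789, §2 (2.12)–(2.14).
  [ConstantinFeffermanIndiana1993]
* Z. Grujić, Comm. Math. Phys. 290 (2009) 861–870, Thm. 1 (tree theorem
  `grujic2009_localized_halfHolder_coherence_holds`). [Grujic2009]
-/

noncomputable section

open MeasureTheory TopologicalSpace Set Function Filter Metric Real InnerProductSpace
open _root_.Topology
open scoped ENNReal NNReal RealInnerProductSpace ContDiff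

namespace Literature.Analysis.FluidPDE


/-! ### Private helpers (copies of the private helpers of `GrujicZhang2006LocalizedHybridCoherenceHolds`) -/

/-- A weak derivative only depends on the values of `f` on `Ω`. [folklore] -/
private theorem hasWeakFDerivOn_congr_left_gzi {Ω : Opens (EuclideanSpace ℝ (Fin 3))}
    {f f' : (EuclideanSpace ℝ (Fin 3)) → (EuclideanSpace ℝ (Fin 3))}
    {g : (EuclideanSpace ℝ (Fin 3)) → (EuclideanSpace ℝ (Fin 3)) →L[ℝ] (EuclideanSpace ℝ (Fin 3))}
    (h : FunctionSpaces.HasWeakFDerivOn Ω volume f g) (hf : Set.EqOn f' f Ω) :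
    FunctionSpaces.HasWeakFDerivOn Ω volume f' g where
  locallyIntegrableOn := h.locallyIntegrableOn.congr
    (ae_restrict_of_forall_mem Ω.isOpen.measurableSet fun x hx => (hf hx).symm)
  locallyIntegrableOn_deriv := h.locallyIntegrableOn_deriv
  integral_fderiv_smul_eq φ v hφ := by
    rw [setIntegral_congr_fun Ω.isOpen.measurableSet (fun x hx => by rw [hf hx])]
    exact h.integral_fderiv_smul_eq φ v hφ

/-- `x ↦ φ(x)² h(x)` is continuous on the whole space when `h` is continuous on an open set
containing the support of the continuous weight `φ`. [folklore] -/
private theorem continuous_sq_mul_of_continuousOn_gzi {φ h : (EuclideanSpace ℝ (Fin 3)) → ℝ}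
    {S : Set (EuclideanSpace ℝ (Fin 3))} (hS : IsOpen S) (hφ : Continuous φ) (hφS : tsupport φ ⊆ S)
    (hh : ContinuousOn h S) : Continuous fun x => φ x ^ 2 * h x := by
  refine continuous_iff_continuousAt.2 fun x => ?_
  by_cases hx : x ∈ S
  · exact (hφ.continuousAt.pow 2).mul (hh.continuousAt (hS.mem_nhds hx))
  · have hφ0 : φ =ᶠ[𝓝 x] 0 := notMem_tsupport_iff_eventuallyEq.1 fun h => hx (hφS h)
    have hev : (fun _ => (0 : ℝ)) =ᶠ[𝓝 x] fun y => φ y ^ 2 * h y := by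
      filter_upwards [hφ0] with y hy
      rw [hy, Pi.zero_apply]; ring
    exact continuousAt_const.congr hev

/-- **Grönwall, differential-to-integral form on a half-open interval.** If `y ≥ 0` has
derivative `D` on an open `I ⊇ [a, t₀)`, `D, α, β` are continuous on `I`, `α, β ≥ 0`,
`D ≤ αy + β` on `I` and `α, β` are integrable on `[a, t₀)`, then
`y(τ) ≤ (y(a) + ∫_{[a,t₀)} β) exp(∫_{[a,t₀)} α)` for all `τ ∈ [a, t₀)`. [folklore] -/
private theorem le_gronwall_of_hasDerivAt_gzi {I : Set ℝ} {a t₀ : ℝ} (haI : Ico a t₀ ⊆ I)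
    {y D α β : ℝ → ℝ} (hy0 : ∀ t, 0 ≤ y t) (hder : ∀ t ∈ I, HasDerivAt y (D t) t)
    (hD : ContinuousOn D I) (hα : ContinuousOn α I) (hβ : ContinuousOn β I)
    (hα0 : ∀ t ∈ I, 0 ≤ α t) (hβ0 : ∀ t ∈ I, 0 ≤ β t) (hle : ∀ t ∈ I, D t ≤ α t * y t + β t)
    (hαi : IntegrableOn α (Ico a t₀)) (hβi : IntegrableOn β (Ico a t₀)) {τ : ℝ} (hτ : τ ∈ Ico a t₀) :
    y τ ≤ (y a + ∫ s in Ico a t₀, β s) * Real.exp (∫ s in Ico a t₀, α s) := by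
  have haτ : a ≤ τ := hτ.1
  have hIcc : Icc a τ ⊆ I := fun t ht => haI ⟨ht.1, ht.2.trans_lt hτ.2⟩
  have hyc : ContinuousOn y I := fun t ht => (hder t ht).continuousAt.continuousWithinAt
  -- Grönwall in integral form on `[a, τ]`
  obtain ⟨By, hBy⟩ := isCompact_Icc.exists_bound_of_continuousOn (hyc.mono hIcc)
  have hineq : ∀ t ∈ Icc a τ, y t ≤ y a + ∫ s in Ioc a t, (α s * y s + β s) := by
    intro t ht
    have hIt : Icc a t ⊆ I := fun s hs => hIcc ⟨hs.1, hs.2.trans ht.2⟩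
    have hDi : IntervalIntegrable D volume a t :=
      (hD.mono (by rw [uIcc_of_le ht.1]; exact hIt)).intervalIntegrable
    have hftc := intervalIntegral.integral_eq_sub_of_hasDerivAt
      (fun s hs => hder s (hIt (by rw [uIcc_of_le ht.1] at hs; exact hs))) hDi
    rw [intervalIntegral.integral_of_le ht.1] at hftc
    have hmono : ∫ s in Ioc a t, D s ≤ ∫ s in Ioc a t, (α s * y s + β s) := by
      refine setIntegral_mono_on ?_ ?_ measurableSet_Ioc fun s hs => hle s (hIt ⟨hs.1.le, hs.2⟩)
      · exact ((hD.mono hIt).integrableOn_compact isCompact_Icc).mono_set Ioc_subset_Icc_self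
      · exact ((((hα.mul hyc).add hβ).mono hIt).integrableOn_compact isCompact_Icc).mono_set
          Ioc_subset_Icc_self
    linarith
  have hg := gronwall_real_Icc haτ hy0 (fun t ht => (le_abs_self _).trans ((Real.norm_eq_abs _).symm.le.trans (hBy t ht)))
    ((hyc.mono hIcc).mono Ioc_subset_Icc_self |>.aestronglyMeasurable measurableSet_Ioc)
    (hα.mono hIcc) (fun t ht => hα0 t (hIcc ht))
    (((hβ.mono hIcc).integrableOn_compact isCompact_Icc).mono_set Ioc_subset_Icc_self)
    (fun t ht => hβ0 t (hIcc (Ioc_subset_Icc_self ht))) hineq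
  -- enlarge the domain of integration to `[a, t₀)`
  have hsub : Ioc a τ ⊆ Ico a t₀ := fun t ht => ⟨ht.1.le, ht.2.trans_lt hτ.2⟩
  have h1 : ∫ s in Ioc a τ, β s ≤ ∫ s in Ico a t₀, β s :=
    setIntegral_mono_set hβi (ae_restrict_of_forall_mem measurableSet_Ico fun t ht => hβ0 t (haI ht))
      (ae_of_all _ hsub)
  have h2 : ∫ s in Ioc a τ, α s ≤ ∫ s in Ico a t₀, α s :=
    setIntegral_mono_set hαi (ae_restrict_of_forall_mem measurableSet_Ico fun t ht => hα0 t (haI ht))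
      (ae_of_all _ hsub)
  have h3 : 0 ≤ y a + ∫ s in Ioc a τ, β s :=
    add_nonneg (hy0 a) (setIntegral_nonneg measurableSet_Ioc fun t ht => hβ0 t (haI (hsub ht)))
  calc y τ ≤ (y a + ∫ s in Ioc a τ, β s) * Real.exp (∫ s in Ioc a τ, α s) := hg
    _ ≤ (y a + ∫ s in Ico a t₀, β s) * Real.exp (∫ s in Ico a t₀, α s) :=
        mul_le_mul (by linarith) (Real.exp_le_exp.2 h2) (Real.exp_pos _).le (by linarith)

/-- **The local dissipation of a Leray–Hopf solution is integrable in time on a region of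
smoothness**: for `B̄(c, r) ⊆ S` and `u` jointly `C^∞` on `I × S` (`I ⊆ (0,T)`), the continuous
function `t ↦ ∫_{B̄(c,r)} ‖∇u(t)‖²` is integrable on `I` — on the region of smoothness the weak
gradient of the energy class is the classical gradient (a.e.), and `∫₀ᵀ∫|∇u|² < ∞`. [folklore] -/
private theorem IsLerayHopfOn.integrableOn_localGradSq_gzi {T ν : ℝ}
    {u₀ : (EuclideanSpace ℝ (Fin 3)) → (EuclideanSpace ℝ (Fin 3))}
    {u : ℝ → (EuclideanSpace ℝ (Fin 3)) → (EuclideanSpace ℝ (Fin 3))}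
    (hLH : IsLerayHopfOn T ν 0 u₀ u) {I : Set ℝ} {S : Set (EuclideanSpace ℝ (Fin 3))}
    (hI : IsOpen I) (hS : IsOpen S) (hIT : I ⊆ Ioo 0 T)
    (hu : ContDiffOn ℝ ∞ (uncurry u) (I ×ˢ S)) {c : (EuclideanSpace ℝ (Fin 3))} {r : ℝ}
    (hcS : closedBall c r ⊆ S)
    (hF : ContinuousOn (fun t => ∫ x in closedBall c r, ‖fderiv ℝ (u t) x‖ ^ 2) I) :
    IntegrableOn (fun t => ∫ x in closedBall c r, ‖fderiv ℝ (u t) x‖ ^ 2) I := by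
  obtain ⟨G, hGae, hGfin, -, -⟩ := hLH.weakGrad_energy
  obtain ⟨-, -, hDU, -, -, -, -⟩ := hLH.vorticity_classical_of_contDiffOn hI hS hIT hu
  have hImeas : MeasurableSet I := hI.measurableSet
  refine ⟨hF.aestronglyMeasurable hImeas, ?_⟩
  -- the a.e. bound `ofReal (F t) ≤ ∫⁻ frob (G t)` on `I`
  have hbound : ∀ᵐ t ∂((volume : Measure ℝ).restrict I),
      ENNReal.ofReal (∫ x in closedBall c r, ‖fderiv ℝ (u t) x‖ ^ 2) ≤
        ∫⁻ x, ENNReal.ofReal (frobeniusNormSq (G t x)) := by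
    have h1 : ∀ᵐ t ∂((volume : Measure ℝ).restrict I), HasWeakGradient (u t) (G t) :=
      ae_restrict_of_ae_restrict_of_subset hIT hGae
    have h2 : ∀ᵐ t ∂((volume : Measure ℝ).restrict I), t ∈ I := ae_restrict_mem hImeas
    filter_upwards [h1, h2] with t hGt ht
    -- the slice and its globalization near `B̄(c, r)`
    have hut : ContDiffOn ℝ ∞ (u t) S := by
      have h : ContDiffOn ℝ ∞ (fun x : (EuclideanSpace ℝ (Fin 3)) => ((t, x) : ℝ × (EuclideanSpace ℝ (Fin 3)))) S :=
        contDiffOn_const.prodMk contDiffOn_id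
      exact hu.comp h fun x hx => ⟨ht, hx⟩
    obtain ⟨V, hV, N, hNo, hKN, hNS, hVu⟩ :=
      ContDiffOn.exists_contDiff_eqOn_nhds_of_isCompact hut hS (isCompact_closedBall c r) hcS
    have hV1 : ContDiff ℝ 1 V := hV.of_le (by exact_mod_cast le_top)
    have hDVeq : ∀ x ∈ N, fderiv ℝ V x = fderiv ℝ (u t) x := fun x hx =>
      (eventuallyEq_of_mem (hNo.mem_nhds hx) hVu).fderiv_eq
    -- the weak gradient is the classical one a.e. on `N`
    have hW1 : FunctionSpaces.HasWeakFDerivOn ⟨N, hNo⟩ volume (u t) (G t) :=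
      FunctionSpaces.HasWeakFDerivOn.mono_set_holds hGt le_top
    have hW2 : FunctionSpaces.HasWeakFDerivOn ⟨N, hNo⟩ volume (u t) (fderiv ℝ V) :=
      hasWeakFDerivOn_congr_left_gzi (FunctionSpaces.HasWeakFDerivOn.of_contDiff_holds ⟨N, hNo⟩ volume hV1)
        fun x hx => (hVu hx).symm
    have hae : G t =ᵐ[volume.restrict N] fderiv ℝ V := FunctionSpaces.HasWeakFDerivOn.unique_holds hW1 hW2
    have hae' : ∀ᵐ x ∂(volume.restrict (closedBall c r)),
        ENNReal.ofReal (frobeniusNormSq (fderiv ℝ (u t) x)) = ENNReal.ofReal (frobeniusNormSq (G t x)) := by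
      have h := ae_restrict_of_ae_restrict_of_subset hKN hae
      have hm : ∀ᵐ x ∂(volume.restrict (closedBall c r)), x ∈ closedBall c r :=
        ae_restrict_mem measurableSet_closedBall
      filter_upwards [h, hm] with x hx hxm
      rw [hx, hDVeq x (hKN hxm)]
    -- the slice gradient is continuous on `B̄(c, r)`
    have hcont : ContinuousOn (fun x => ‖fderiv ℝ (u t) x‖ ^ 2) (closedBall c r) := by
      have hc : Continuous (fun x : (EuclideanSpace ℝ (Fin 3)) => ((t, x) : ℝ × (EuclideanSpace ℝ (Fin 3)))) :=
        continuous_const.prodMk continuous_id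
      exact ((hDU.comp hc.continuousOn fun x hx => ⟨ht, hcS hx⟩).norm).pow 2
    have hint : IntegrableOn (fun x => ‖fderiv ℝ (u t) x‖ ^ 2) (closedBall c r) :=
      hcont.integrableOn_compact (isCompact_closedBall c r)
    rw [ofReal_integral_eq_lintegral_ofReal hint (ae_of_all _ fun x => by positivity)]
    calc ∫⁻ x in closedBall c r, ENNReal.ofReal (‖fderiv ℝ (u t) x‖ ^ 2)
        ≤ ∫⁻ x in closedBall c r, ENNReal.ofReal (frobeniusNormSq (fderiv ℝ (u t) x)) :=
          lintegral_mono fun x => ENNReal.ofReal_le_ofReal (sq_opNorm_le_frobeniusNormSq _)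
      _ = ∫⁻ x in closedBall c r, ENNReal.ofReal (frobeniusNormSq (G t x)) := lintegral_congr_ae hae'
      _ ≤ ∫⁻ x, ENNReal.ofReal (frobeniusNormSq (G t x)) := setLIntegral_le_lintegral _ _
  -- finiteness
  have hle : ∫⁻ t in I, ‖∫ x in closedBall c r, ‖fderiv ℝ (u t) x‖ ^ 2‖ₑ ≤
      ∫⁻ t in Ioo 0 T, ∫⁻ x, ENNReal.ofReal (frobeniusNormSq (G t x)) := by
    calc ∫⁻ t in I, ‖∫ x in closedBall c r, ‖fderiv ℝ (u t) x‖ ^ 2‖ₑ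
        = ∫⁻ t in I, ENNReal.ofReal (∫ x in closedBall c r, ‖fderiv ℝ (u t) x‖ ^ 2) :=
          lintegral_congr fun t => by
            rw [Real.enorm_eq_ofReal (setIntegral_nonneg measurableSet_closedBall fun x _ => by positivity)]
      _ ≤ ∫⁻ t in I, ∫⁻ x, ENNReal.ofReal (frobeniusNormSq (G t x)) := lintegral_mono_ae hbound
      _ ≤ ∫⁻ t in Ioo 0 T, ∫⁻ x, ENNReal.ofReal (frobeniusNormSq (G t x)) :=
          lintegral_mono_set hIT
  exact lt_of_le_of_lt hle hGfin

/-- **The local kinetic energy of a Leray–Hopf solution is bounded by twice the initial energy**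
(energy inequality with `f = 0`). [folklore] -/
private theorem IsLerayHopfOn.setIntegral_norm_sq_le_gzi {T ν : ℝ} (hν : 0 ≤ ν)
    {u₀ : (EuclideanSpace ℝ (Fin 3)) → (EuclideanSpace ℝ (Fin 3))}
    {u : ℝ → (EuclideanSpace ℝ (Fin 3)) → (EuclideanSpace ℝ (Fin 3))}
    (hLH : IsLerayHopfOn T ν 0 u₀ u) {t : ℝ} (ht : t ∈ Icc 0 T) (A : Set (EuclideanSpace ℝ (Fin 3))) :
    ∫ x in A, ‖u t x‖ ^ 2 ≤ 2 * VectorCalculus.kineticEnergy u₀ := by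
  obtain ⟨G, -, -, hen, -⟩ := hLH.weakGrad_energy
  have h := hen t ht
  have hf0 : ∫ τ in (0 : ℝ)..t, ∫ x, ⟪(0 : ℝ → (EuclideanSpace ℝ (Fin 3)) → (EuclideanSpace ℝ (Fin 3))) τ x, u τ x⟫ = 0 := by
    simp
  rw [hf0, add_zero] at h
  have hdiss : 0 ≤ ν * (∫⁻ τ in Ioo 0 t, ∫⁻ x, ENNReal.ofReal (frobeniusNormSq (G τ x))).toReal :=
    mul_nonneg hν ENNReal.toReal_nonneg
  have hint : Integrable (fun x => ‖u t x‖ ^ 2) :=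
    (memLp_two_iff_integrable_sq_norm (hLH.memLp t ht).1).1 (hLH.memLp t ht)
  have hKE : VectorCalculus.kineticEnergy (u t) = 2⁻¹ * ∫ x, ‖u t x‖ ^ 2 := rfl
  calc ∫ x in A, ‖u t x‖ ^ 2 ≤ ∫ x, ‖u t x‖ ^ 2 :=
        setIntegral_le_integral hint (ae_of_all _ fun x => by positivity)
    _ = 2 * VectorCalculus.kineticEnergy (u t) := by rw [hKE]; ring
    _ ≤ 2 * VectorCalculus.kineticEnergy u₀ := by linarith

/-! ### The discharge -/

set_option maxHeartbeats 800000 in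
/-- **Grujić–Zhang 2006, Theorem 1.2 — proved.** A weak-`L^{6/5}` bound on the triple-product
depletion factor `λ_{Q_{2r₀}(x₀,t₀)}` of the vorticity directions over the high-vorticity points of
a parabolic cylinder of smoothness of a Leray–Hopf solution bounds the localized enstrophy up to
the top of the cylinder: the named fact `grujicZhang2006_localized_integral_coherence` holds
(Z. Grujić, Qi S. Zhang, Comm. Math. Phys. 262 (2006), Thm. 1.2 p. 558; proof p. 563 with §2–§3
of the proof of Thm. 1.1). Assembled from the measurable majorant of the kernel
(`exists_measurable_ge_of_weak`), `IsLerayHopfOn.exists_weight_localEnstrophy_deriv_le_kernel`,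
the Leray–Hopf energy structure, Grönwall's inequality and a finite cover of `B̄(x₀, r₀)`; see the
module docstring (the datum hypotheses are not used). [cite: GrujicZhang2006, Thm. 1.2 (p. 558) with (1.3), proof p. 563 and §2 (2.4)–(2.6), §3 (3.2)–(3.11)] -/
theorem grujicZhang2006_localized_integral_coherence_holds :
    grujicZhang2006_localized_integral_coherence := by
  intro T _hT u₀ u hLH _hu₀ _hω₀ x₀ t₀ r₀ d hr₀ h9r₀ ht₀T hd hsm hΛ
  obtain ⟨Λ, hΛtop, hweak0⟩ := hΛ
  -- ### the cylinder of smoothness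
  set I : Set ℝ := Ioo (t₀ - (2 * r₀) ^ 2) t₀ with hIdef
  set S : Set (EuclideanSpace ℝ (Fin 3)) := ball x₀ (2 * r₀) with hSdef
  have hI : IsOpen I := isOpen_Ioo
  have hS : IsOpen S := isOpen_ball
  have hIT : I ⊆ Ioo 0 T := fun t ht => ⟨by have := ht.1; nlinarith, ht.2.trans_le ht₀T⟩
  have hu : ContDiffOn ℝ ∞ (uncurry u) (I ×ˢ S) := hsm
  obtain ⟨-, -, hDU, hω0, -, -, -⟩ := hLH.vorticity_classical_of_contDiffOn hI hS hIT hu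
  -- slices through `t ∈ I` are continuous on `S`
  have hpmk : ∀ t : ℝ, Continuous (fun x : (EuclideanSpace ℝ (Fin 3)) => ((t, x) : ℝ × (EuclideanSpace ℝ (Fin 3)))) :=
    fun t => continuous_const.prodMk continuous_id
  have hslDU : ∀ t ∈ I, ContinuousOn (fun x => fderiv ℝ (u t) x) S := fun t ht =>
    hDU.comp (hpmk t).continuousOn fun x hx => ⟨ht, hx⟩
  have hslω : ∀ t ∈ I, ContinuousOn (fun x => curl (u t) x) S := fun t ht =>
    hω0.comp (hpmk t).continuousOn fun x hx => ⟨ht, hx⟩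
  -- ### the kernel: a measurable majorant of `z ↦ 1_{B(0,3r₀)}(−z) λ(−z)`
  set k₀ : (EuclideanSpace ℝ (Fin 3)) → ℝ≥0∞ := fun z =>
    (ball (0 : EuclideanSpace ℝ (Fin 3)) (3 * r₀)).indicator
      (GrujicZhang2006.depletionFactor u x₀ t₀ r₀ d) (-z) with hk₀
  have hweak_k₀ : ∀ l : ℝ, 0 < l →
      ENNReal.ofReal l ^ (6 / 5 : ℝ) * volume {z | ENNReal.ofReal l < k₀ z} ≤ Λ := by
    intro l hl
    have hset : {z | ENNReal.ofReal l < k₀ z} =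
        Neg.neg ⁻¹' {y ∈ ball (0 : EuclideanSpace ℝ (Fin 3)) (3 * r₀) |
          ENNReal.ofReal l < GrujicZhang2006.depletionFactor u x₀ t₀ r₀ d y} := by
      ext z
      simp only [mem_setOf_eq, mem_preimage, hk₀]
      constructor
      · intro h
        by_cases hz : -z ∈ ball (0 : EuclideanSpace ℝ (Fin 3)) (3 * r₀)
        · rw [indicator_of_mem hz] at h
          exact ⟨hz, h⟩
        · rw [indicator_of_notMem hz] at h
          exact absurd h (not_lt.2 bot_le)
      · rintro ⟨hz, h⟩
        rw [indicator_of_mem hz]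
        exact h
    rw [hset, Measure.measure_preimage_neg]
    exact hweak0 l hl
  obtain ⟨k, hkm, hk₀k, hweak⟩ :=
    exists_measurable_ge_of_weak volume k₀ (by norm_num : (0 : ℝ) ≤ 6 / 5) Λ hweak_k₀
  have hΛ0 : 0 ≤ Λ.toReal := ENNReal.toReal_nonneg
  have hweak' : ∀ l : ℝ, 0 < l →
      ENNReal.ofReal l ^ (6 / 5 : ℝ) * volume {z | ENNReal.ofReal l < k z} ≤ ENNReal.ofReal Λ.toReal := by
    intro l hl
    rw [ENNReal.ofReal_toReal hΛtop.ne]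
    exact hweak l hl
  -- ### the radius of the small balls and the time `a`
  set s : ℝ := r₀ / 16 with hsdef
  have hs : 0 < s := by positivity
  set a : ℝ := t₀ - 2 * r₀ ^ 2 with hadef
  have haI : Ico a t₀ ⊆ I := fun t ht => ⟨by have := ht.1; nlinarith, ht.2⟩
  have ha : a ∈ I := haI ⟨le_rfl, by nlinarith⟩
  have hIfin : volume (Ico a t₀) < ⊤ := measure_Ico_lt_top
  have hIco_meas : MeasurableSet (Ico a t₀) := measurableSet_Ico
  -- the initial energy
  set E₀ : ℝ := 2 * VectorCalculus.kineticEnergy u₀ with hE₀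
  have hEbound : ∀ t ∈ I, ∀ A : Set (EuclideanSpace ℝ (Fin 3)), ∫ x in A, ‖u t x‖ ^ 2 ≤ E₀ := fun t ht A =>
    hLH.setIntegral_norm_sq_le_gzi zero_le_one ⟨(hIT ht).1.le, (hIT ht).2.le⟩ A
  -- ### the bound on one small ball
  have key : ∀ c ∈ closedBall x₀ r₀, ∃ Cc : ℝ, ∀ t ∈ Ioo (t₀ - r₀ ^ 2) t₀,
      ∫ x in ball c (s / 2), ‖curl (u t) x‖ ^ 2 ≤ Cc := by
    intro c hc
    rw [mem_closedBall] at hc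
    have hcS : closedBall c (12 * s) ⊆ S := fun x hx => by
      rw [mem_closedBall] at hx
      rw [hSdef, mem_ball]
      calc dist x x₀ ≤ dist x c + dist c x₀ := dist_triangle _ _ _
        _ < 2 * r₀ := by rw [hsdef] at hx; linarith
    have h6c2 : ball c (6 * s) ⊆ ball x₀ (2 * r₀) := fun x hx => by
      rw [mem_ball] at hx ⊢
      calc dist x x₀ ≤ dist x c + dist c x₀ := dist_triangle _ _ _
        _ < 2 * r₀ := by rw [hsdef] at hx; linarith
    -- the kernel hypothesis on `B(c, 6s)`: the definition of the supremum `λ`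
    have hdir : ∀ t ∈ I, ∀ x ∈ ball c (6 * s), ∀ y ∈ ball c (6 * s),
        d < ‖curl (u t) x‖ → d < ‖curl (u t) y‖ →
          ENNReal.ofReal (|⟪x - y, cross (vorticityDirection (curl (u t)) y)
              (vorticityDirection (curl (u t)) x)⟫| / ‖x - y‖ ^ 4) ≤ k (x - y) := by
      intro t ht x hx y hy hMx _hMy
      refine le_trans ?_ (hk₀k (x - y))
      have hyx : y - x ∈ ball (0 : EuclideanSpace ℝ (Fin 3)) (3 * r₀) := by
        rw [mem_ball_zero_iff, ← dist_eq_norm]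
        calc dist y x ≤ dist y c + dist x c := dist_triangle_right _ _ _
          _ < 6 * s + 6 * s := add_lt_add (mem_ball.1 hy) (mem_ball.1 hx)
          _ ≤ 3 * r₀ := by rw [hsdef]; linarith
      have hk₀eq : k₀ (x - y) = GrujicZhang2006.depletionFactor u x₀ t₀ r₀ d (y - x) := by
        rw [hk₀]
        simp only [neg_sub]
        rw [indicator_of_mem hyx]
      rw [hk₀eq]
      have hterm : ENNReal.ofReal (|⟪y - x, cross (vorticityDirection (curl (u t)) (x + (y - x)))
          (vorticityDirection (curl (u t)) x)⟫| / ‖y - x‖ ^ 4) ≤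
          GrujicZhang2006.depletionFactor u x₀ t₀ r₀ d (y - x) := by
        unfold GrujicZhang2006.depletionFactor
        exact le_iSup_of_le t (le_iSup_of_le ht (le_iSup_of_le x
          (le_iSup_of_le (h6c2 hx) (le_iSup_of_le hMx.le le_rfl))))
      have e1 : x + (y - x) = y := by abel
      have e2 : |⟪y - x, cross (vorticityDirection (curl (u t)) y) (vorticityDirection (curl (u t)) x)⟫| =
          |⟪x - y, cross (vorticityDirection (curl (u t)) y) (vorticityDirection (curl (u t)) x)⟫| := by
        rw [← neg_sub x y, inner_neg_left, abs_neg]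
      rw [e1, e2, norm_sub_rev] at hterm
      exact hterm
    obtain ⟨φ, D, A₀, A₁, B₀, B₁, hφ1, hφ01, hA₀, hA₁, hB₀, hB₁, hφc, hφs, hYc, hFc, hEc,
      hDc, hder, hle⟩ :=
      hLH.exists_weight_localEnstrophy_deriv_le_kernel one_pos hI hS hIT hu c hs hcS hkm hΛ0 hweak'
        hd hdir
    -- names for the local sizes
    set Y : ℝ → ℝ := fun t => ∫ x in closedBall c (6 * s), ‖curl (u t) x‖ ^ 2 with hYdef
    set F : ℝ → ℝ := fun t => ∫ x in closedBall c (6 * s), ‖fderiv ℝ (u t) x‖ ^ 2 with hFdef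
    set E : ℝ → ℝ := fun t => ∫ x in closedBall c (6 * s), ‖u t x‖ ^ 2 with hEdef
    set y : ℝ → ℝ := fun t => ∫ x, φ x ^ 2 * ‖curl (u t) x‖ ^ 2 with hydef
    have hY0 : ∀ t, 0 ≤ Y t := fun t => setIntegral_nonneg measurableSet_closedBall fun x _ => by positivity
    have hF0 : ∀ t, 0 ≤ F t := fun t => setIntegral_nonneg measurableSet_closedBall fun x _ => by positivity
    have hE0 : ∀ t, 0 ≤ E t := fun t => setIntegral_nonneg measurableSet_closedBall fun x _ => by positivity
    have hy0 : ∀ t, 0 ≤ y t := fun t => integral_nonneg fun x => by positivity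
    have hEle : ∀ t ∈ I, E t ≤ E₀ := fun t ht => hEbound t ht _
    have h6cS : closedBall c (6 * s) ⊆ S := (closedBall_subset_closedBall (by linarith)).trans hcS
    -- `Y ≤ ‖curlCLM‖² F`
    have hYF : ∀ t ∈ I, Y t ≤ ‖curlCLM‖ ^ 2 * F t := by
      intro t ht
      have hcont : ContinuousOn (fun x => ‖fderiv ℝ (u t) x‖ ^ 2) (closedBall c (6 * s)) :=
        fun x hx => ((hslDU t ht x (h6cS hx)).norm.pow 2).mono h6cS
      have hint : IntegrableOn (fun x => ‖fderiv ℝ (u t) x‖ ^ 2) (closedBall c (6 * s)) :=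
        hcont.integrableOn_compact (isCompact_closedBall _ _)
      calc Y t ≤ ∫ x in closedBall c (6 * s), ‖curlCLM‖ ^ 2 * ‖fderiv ℝ (u t) x‖ ^ 2 := by
            refine setIntegral_mono_on ?_ (hint.const_mul _) measurableSet_closedBall fun x _ => ?_
            · have hc2 : ContinuousOn (fun x => ‖curl (u t) x‖ ^ 2) (closedBall c (6 * s)) :=
                fun x hx => ((hslω t ht x (h6cS hx)).norm.pow 2).mono h6cS
              exact hc2.integrableOn_compact (isCompact_closedBall _ _)
            · rw [curl_eq_curlCLM, ← mul_pow]
              exact pow_le_pow_left₀ (norm_nonneg _) (ContinuousLinearMap.le_opNorm _ _) 2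
        _ = ‖curlCLM‖ ^ 2 * F t := integral_const_mul _ _
    -- integrability of the coefficients on `[a, t₀)`
    have hFi : IntegrableOn F (Ico a t₀) :=
      (hLH.integrableOn_localGradSq_gzi hI hS hIT hu h6cS hFc).mono_set haI
    have hYi : IntegrableOn Y (Ico a t₀) := by
      refine Integrable.mono' (hFi.const_mul (‖curlCLM‖ ^ 2))
        ((hYc.mono haI).aestronglyMeasurable hIco_meas) ?_
      refine ae_restrict_of_forall_mem hIco_meas fun t ht => ?_
      rw [Real.norm_of_nonneg (hY0 t)]
      exact hYF t (haI ht)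
    have hEi : IntegrableOn E (Ico a t₀) := by
      refine Integrable.mono' (integrableOn_const (C := E₀) (hs := hIfin.ne))
        ((hEc.mono haI).aestronglyMeasurable hIco_meas) ?_
      refine ae_restrict_of_forall_mem hIco_meas fun t ht => ?_
      rw [Real.norm_of_nonneg (hE0 t)]
      exact hEle t (haI ht)
    -- the coefficients `α`, `β`
    set α : ℝ → ℝ := fun t => A₀ + A₁ * (Y t + F t + E t) with hαdef
    set β : ℝ → ℝ := fun t => (B₀ + B₁ * E t ^ 2) * (Y t + F t) with hβdef
    have hαc : ContinuousOn α I :=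
      continuousOn_const.add (continuousOn_const.mul ((hYc.add hFc).add hEc))
    have hβc : ContinuousOn β I := (continuousOn_const.add (continuousOn_const.mul (hEc.pow 2))).mul (hYc.add hFc)
    have hα0 : ∀ t ∈ I, 0 ≤ α t := fun t _ => by
      have := hY0 t; have := hF0 t; have := hE0 t; positivity
    have hβ0 : ∀ t ∈ I, 0 ≤ β t := fun t _ => by
      have := hY0 t; have := hF0 t; have := hE0 t; positivity
    have hαi : IntegrableOn α (Ico a t₀) :=
      (integrableOn_const (C := A₀) (hs := hIfin.ne)).add (((hYi.add hFi).add hEi).const_mul A₁)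
    have hβi : IntegrableOn β (Ico a t₀) := by
      refine Integrable.mono' (((hYi.add hFi)).const_mul (B₀ + B₁ * E₀ ^ 2))
        ((hβc.mono haI).aestronglyMeasurable hIco_meas) ?_
      refine ae_restrict_of_forall_mem hIco_meas fun t ht => ?_
      rw [Real.norm_of_nonneg (hβ0 t (haI ht))]
      have h1 : E t ^ 2 ≤ E₀ ^ 2 := pow_le_pow_left₀ (hE0 t) (hEle t (haI ht)) 2
      have h2 : 0 ≤ Y t + F t := add_nonneg (hY0 t) (hF0 t)
      show (B₀ + B₁ * E t ^ 2) * (Y t + F t) ≤ (B₀ + B₁ * E₀ ^ 2) * (Y t + F t)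
      exact mul_le_mul_of_nonneg_right (by nlinarith) h2
    have hle' : ∀ t ∈ I, D t ≤ α t * y t + β t := fun t ht => hle t ht
    -- Grönwall
    have hgr : ∀ τ ∈ Ico a t₀, y τ ≤ (y a + ∫ s' in Ico a t₀, β s') * Real.exp (∫ s' in Ico a t₀, α s') :=
      fun τ hτ => le_gronwall_of_hasDerivAt_gzi haI hy0 hder hDc hαc hβc hα0 hβ0 hle' hαi hβi hτ
    refine ⟨(y a + ∫ s' in Ico a t₀, β s') * Real.exp (∫ s' in Ico a t₀, α s'), fun t ht => ?_⟩
    have htI : t ∈ Ico a t₀ := ⟨by have := ht.1; nlinarith, ht.2⟩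
    refine le_trans ?_ (hgr t htI)
    -- `∫_{B(c, s/2)} |ω|² ≤ ∫ φ²|ω|²`
    have hωc : ContinuousOn (fun x => ‖curl (u t) x‖ ^ 2) S :=
      fun x hx => ((hslω t (haI htI) x hx).norm.pow 2)
    have hφS : tsupport φ ⊆ S := hφs.trans ((closedBall_subset_closedBall (by linarith)).trans hcS)
    have hprod : Continuous fun x => φ x ^ 2 * ‖curl (u t) x‖ ^ 2 :=
      continuous_sq_mul_of_continuousOn_gzi hS hφc hφS hωc
    have hsupp : HasCompactSupport φ :=
      (isCompact_closedBall c s).of_isClosed_subset (isClosed_tsupport φ) hφs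
    have hint : Integrable fun x => φ x ^ 2 * ‖curl (u t) x‖ ^ 2 := by
      refine hprod.integrable_of_hasCompactSupport (hsupp.mono fun x hx => ?_)
      rw [mem_support] at hx ⊢
      intro h; exact hx (by rw [h]; ring)
    calc ∫ x in ball c (s / 2), ‖curl (u t) x‖ ^ 2
        = ∫ x in ball c (s / 2), φ x ^ 2 * ‖curl (u t) x‖ ^ 2 :=
          setIntegral_congr_fun measurableSet_ball fun x hx => by rw [hφ1 x hx]; ring
      _ ≤ ∫ x, φ x ^ 2 * ‖curl (u t) x‖ ^ 2 :=
          setIntegral_le_integral hint (ae_of_all _ fun x => by positivity)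
  -- ### the finite cover of `B̄(x₀, r₀)`
  obtain ⟨tc, htc, htcfin, hcover⟩ := finite_cover_balls_of_compact (isCompact_closedBall x₀ r₀)
    (e := s / 2) (by positivity)
  choose! Cb hCb using key
  refine ⟨∑ c ∈ htcfin.toFinset, Cb c, fun t ht => ?_⟩
  have htI : t ∈ I := ⟨by have := ht.1; nlinarith, ht.2⟩
  have hωc : ContinuousOn (fun x => ‖curl (u t) x‖ ^ 2) S :=
    fun x hx => ((hslω t htI x hx).norm.pow 2)
  -- integrability of the pieces
  have hRS : closedBall x₀ r₀ ⊆ S := fun x hx => by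
    rw [mem_closedBall] at hx; rw [hSdef, mem_ball]; linarith
  have hintR : IntegrableOn (fun x => ‖curl (u t) x‖ ^ 2) (ball x₀ r₀) :=
    ((hωc.mono hRS).integrableOn_compact (isCompact_closedBall x₀ r₀)).mono_set ball_subset_closedBall
  have hintc : ∀ c ∈ htcfin.toFinset, IntegrableOn (fun x => ‖curl (u t) x‖ ^ 2) (ball c (s / 2)) := by
    intro c hc
    have hc' : c ∈ closedBall x₀ r₀ := htc (htcfin.mem_toFinset.1 hc)
    rw [mem_closedBall] at hc'
    have hsub : closedBall c (s / 2) ⊆ S := fun x hx => by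
      rw [mem_closedBall] at hx; rw [hSdef, mem_ball]
      calc dist x x₀ ≤ dist x c + dist c x₀ := dist_triangle _ _ _
        _ < 2 * r₀ := by rw [hsdef] at hx; linarith
    exact ((hωc.mono hsub).integrableOn_compact (isCompact_closedBall c (s / 2))).mono_set
      ball_subset_closedBall
  -- pointwise: the indicator of `B(x₀, r₀)` is below the sum of the indicators of the cover
  have hpt : ∀ x, (ball x₀ r₀).indicator (fun x => ‖curl (u t) x‖ ^ 2) x ≤
      ∑ c ∈ htcfin.toFinset, (ball c (s / 2)).indicator (fun x => ‖curl (u t) x‖ ^ 2) x := by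
    intro x
    by_cases hx : x ∈ ball x₀ r₀
    · rw [indicator_of_mem hx]
      obtain ⟨c, hc, hxc⟩ : ∃ c ∈ tc, x ∈ ball c (s / 2) := by
        have := hcover (ball_subset_closedBall hx)
        simpa only [mem_iUnion, exists_prop] using this
      have hcmem : c ∈ htcfin.toFinset := htcfin.mem_toFinset.2 hc
      refine le_trans (le_of_eq (indicator_of_mem hxc (fun x => ‖curl (u t) x‖ ^ 2)).symm) ?_
      exact Finset.single_le_sum (f := fun c => (ball c (s / 2)).indicator (fun x => ‖curl (u t) x‖ ^ 2) x)
        (fun c _ => indicator_nonneg (fun y _ => by positivity) _) hcmem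
    · rw [indicator_of_notMem hx]
      exact Finset.sum_nonneg fun c _ => indicator_nonneg (fun y _ => by positivity) _
  have hIind : Integrable fun x => (ball x₀ r₀).indicator (fun x => ‖curl (u t) x‖ ^ 2) x :=
    (integrable_indicator_iff measurableSet_ball).2 hintR
  have hIsum : Integrable fun x =>
      ∑ c ∈ htcfin.toFinset, (ball c (s / 2)).indicator (fun x => ‖curl (u t) x‖ ^ 2) x :=
    integrable_finsetSum _ fun c hc => (integrable_indicator_iff measurableSet_ball).2 (hintc c hc)
  calc ∫ x in ball x₀ r₀, ‖curl (u t) x‖ ^ 2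
      = ∫ x, (ball x₀ r₀).indicator (fun x => ‖curl (u t) x‖ ^ 2) x :=
        (integral_indicator measurableSet_ball).symm
    _ ≤ ∫ x, ∑ c ∈ htcfin.toFinset, (ball c (s / 2)).indicator (fun x => ‖curl (u t) x‖ ^ 2) x :=
        integral_mono hIind hIsum hpt
    _ = ∑ c ∈ htcfin.toFinset, ∫ x, (ball c (s / 2)).indicator (fun x => ‖curl (u t) x‖ ^ 2) x :=
        integral_finsetSum _ fun c hc => (integrable_indicator_iff measurableSet_ball).2 (hintc c hc)
    _ = ∑ c ∈ htcfin.toFinset, ∫ x in ball c (s / 2), ‖curl (u t) x‖ ^ 2 :=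
        Finset.sum_congr rfl fun c _ => integral_indicator measurableSet_ball
    _ ≤ ∑ c ∈ htcfin.toFinset, Cb c :=
        Finset.sum_le_sum fun c hc => hCb c (htc (htcfin.mem_toFinset.1 hc)) t ht


/-- **Grujić–Zhang 2006, Remark 1 — unconditionally** (p. 558: "Theorem 1.2 contains Theorem 1.1
at `q = 2`"): local `½`-Hölder coherence of the vorticity direction off the high-vorticity points of
`Q_{2r₀}(x₀, t₀)`, in the printed one-sided form `|ξ(x+y,t) × ξ(x,t)| ≤ c|y|^{1/2}` (`|y| ≤ r₀`),
bounds the localized enstrophy up to `t₀` — the tree's conditional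
`grujicZhang2006_localized_halfHolder_of_integral` fed with
`grujicZhang2006_localized_integral_coherence_holds`. [cite: GrujicZhang2006, Remark 1 (p. 558) with Thm. 1.2] -/
theorem grujicZhang2006_localized_halfHolder_coherence_q2 :
    ∀ ⦃T : ℝ⦄, 0 < T →
      ∀ ⦃u₀ : EuclideanSpace ℝ (Fin 3) → EuclideanSpace ℝ (Fin 3)⦄
        ⦃u : ℝ → EuclideanSpace ℝ (Fin 3) → EuclideanSpace ℝ (Fin 3)⦄,
      IsLerayHopfOn T 1 0 u₀ u →
      ContDiff ℝ 1 u₀ → Integrable (curl u₀) →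
      ∀ (x₀ : EuclideanSpace ℝ (Fin 3)) (t₀ r₀ d c : ℝ),
        0 < r₀ → (3 * r₀) ^ 2 ≤ t₀ → t₀ ≤ T → 0 < d → 0 < c →
      ContDiffOn ℝ (⊤ : ℕ∞) (uncurry u) (Ioo (t₀ - (2 * r₀) ^ 2) t₀ ×ˢ ball x₀ (2 * r₀)) →
      (∀ t ∈ Ioo (t₀ - (2 * r₀) ^ 2) t₀, ∀ x ∈ ball x₀ (2 * r₀), d ≤ ‖curl (u t) x‖ →
        ∀ y : EuclideanSpace ℝ (Fin 3), ‖y‖ ≤ r₀ →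
          ‖cross (vorticityDirection (curl (u t)) (x + y)) (vorticityDirection (curl (u t)) x)‖ ≤
            c * Real.sqrt ‖y‖) →
      ∃ M : ℝ, ∀ t ∈ Ioo (t₀ - r₀ ^ 2) t₀, ∫ x in ball x₀ r₀, ‖curl (u t) x‖ ^ 2 ≤ M :=
  grujicZhang2006_localized_halfHolder_of_integral grujicZhang2006_localized_integral_coherence_holds

end Literature.Analysis.FluidPDE

end
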